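import Mathlib
import Summits.QuantumFields.BalabanUV.Beta.EriceRemainderEnclosureHistoryAutonomyComparisonAgeCompositionStaticChainResolvent
import Summits.QuantumFields.BalabanUV.Beta.EriceRemainderEnclosureHistoryAutonomyComparisonAgeCompositionStaticChainObserverRatios
import Summits.QuantumFields.BalabanUV.Beta.EriceRemainderEnclosureHistoryAutonomyComparisonAgeCompositionStaticChainAdjacentEnvelopes
import Summits.QuantumFields.BalabanUV.Beta.EriceRemainderEnclosureHistoryAutonomyComparisonAgeCompositionStaticChainAdjacentRatioEnvelopes
import Summits.QuantumFields.BalabanUV.Beta.EriceRemainderEnclosureHistoryAutonomyComparisonAgeCompositionStaticChainAdjacentStep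
import Summits.QuantumFields.BalabanUV.Beta.EriceRemainderEnclosureHistoryAutonomyComparisonAgeCompositionStaticChainCrossAmplifications

/-!
# EriceRemainderEnclosureHistoryAutonomyComparisonAgeCompositionStaticChainAdjacentStepLattice — (E78i) THE CAPSTONE OF STATION (E78): the observer step (◆) for
# EVERY LEVEL-COUPLED CONFIGURATION of older ages above an adjacent pair `(z+1, z)`, `z ≥ 16`, and every admissible load of the new age — the binding infinite
# family of the observer induction is CLOSED in the tree, with every ingredient proved

Cell `pub-balaban`, β-function sub-cell, BINDER row D4 «RemainderConst leaves for Bałaban's split» (`HOME/BINDER-OWNERS.md`; owner lineage `b2b-balaban-beta-an4`;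
this file by co-owner #2 lineage `b2b-balaban-beta-d4-p2`, generation 69), β-FLOW TEAM duty (1), FREEZE (0) honoured (def-free; imports (E78a)–(E78h) and (E74a) by name).

HONEST FRAMING (page 1, verbatim and binding).  *"Discharging BetaPertH makes Bałaban's UV stability UNCONDITIONAL — a real constructive-QFT result; it is
NOT the continuum limit and NOT the Clay problem."*  THIS FILE DISCHARGES NOTHING OF THE KIND.  Elementary real algebra and finite sums — hypotheses of a census,
not facts; the age profile of Bałaban's (1.22) limit functional is NOT PRINTED ([I] p. 298; GAPS G-t4-U2-1∕-2) and NOT asserted.  Row D4 class UNCHANGED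
(critical-path width 0; instance 0∕1; D4 DISCHARGE NO DATE).  HONEST DEPENDENCY: continuum YM on T⁴ ⇐ BetaPertH ∧ nine spine estimates (0/9 proved); BetaPertH ⇐
(D1) ∧ (D4) ∧ CAP+tail; G-an2-4 gates asym, D1 and NE2/3/4.

THE POINT (census sense (α); route (N′); README `HOME/b2b-balaban-beta-d4-p2/g69/e78/README.md` §4–§6).  The first-order static closure of the window-mass chain over the
level-coupled system was reduced by (E78a)–(E78c) to the OBSERVER INDUCTION whose step is the resolvent inequality (◆), and (◆) to a one-dimensional scalar
certificate per geometry.  (E78d)–(E78h) proved that certificate and all its numeric envelopes for the adjacent pairs `z ≥ 16`.  §2 **`adjacent_step_lattice`** WIRES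
them: given `n ≥ 1` older ages `k_l ≥ z+2` with loads `x_l ≥ 0`, the exact positive levels `a` and the exact responses `cy`, `cz` of the old system to the reads of
the scales `z+1` and `z` (letters with defining equations for the read windows `S_{k_l,z+1}`, `S_{k_l,z}`, `S_{z+1,k_l}`, `S_{z,k_l}`, the four amplifications `Ψyy`, `Ψyz`,
`Ψzy`, `Ψzz`, the window mass `Ω_z`, and `σ`, `φ`, `s`), a defect `θ ≤ 0.7856` ((E78f) `thetabar_le_envelope` for `θ̄((z+1)∕z)`) and a load `0 ≤ x_y` below the cap
((E78b) `pivot_pos`), the conclusion is LITERALLY the hypothesis `hdia` of (E78a) `observer_step` (`κ = 31∕40`, `q = (z+1)∕z`).  Chain of the proof: charge ratios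
`α ∈ [16∕17, 1]` ((E78c) `charge_ratio_ge`, (E78b) `readWindow_mono_right`); response ratios `cz ∈ [1, 1.0607]·cy` ((E78c) `read_ratio_ge`, (E78f) `read_ratio_le`, (E78h)
`response_ratio_bounds`); the cross Gram ((E78h) `cross_gram_bounds`); the structural room `Ω_z(1.3725 + 1.6568Ψyy) ≤ Ψyy` ((E78b) `return_amplification_ge_lattice`,
(E78e) `lam1_ge`∕`lam2_ge`, §1 `rowsum_lt_one` for `λ₂Ω_y < 1`, `Ω_z ≤ Ω_y`); the envelopes ((E78e)); then (E78g) `adjacent_step`.  WHAT THIS CLOSES: for the binding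
infinite family of the induction (adjacent pairs, `z ≥ 16`; the adversarial supremum 0.914 of README §4 lives here) the observer bound `N_z ≤ (1+2κΨ_zz)(1−Ω_z)`
PROPAGATES — unconditionally in the level-coupled letters.  WHAT REMAINS for route (N′) at first order (README §6): adjacent `z ≤ 15` (15 certificates), non-adjacent
pairs (`q`-bands, margins ≥ 11 %), the assembly of the induction as one theorem, then identification with the flow and MONO∕MONO′.  NOT CLAIMED: those; the static
closure as a theorem; anything printed.

WHAT IS PROVED ([folklore]; 0 `def`, 0 sorry).  §1 `rowsum_lt_one`.  §2 **`adjacent_step_lattice`**.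
-/
noncomputable section
open Finset

namespace Summit.QuantumFields.BalabanUV.Beta.EriceRemainderEnclosureHistoryAutonomyComparisonAgeCompositionStaticChainAdjacentStepLattice

open Summit.QuantumFields.BalabanUV.Beta.EriceRemainderEnclosureHistoryAutonomyComparisonAgeCompositionStaticChainCertificate
open Summit.QuantumFields.BalabanUV.Beta.EriceRemainderEnclosureHistoryAutonomyComparisonAgeCompositionStaticChainResolvent
open Summit.QuantumFields.BalabanUV.Beta.EriceRemainderEnclosureHistoryAutonomyComparisonAgeCompositionStaticChainObserverRatios
open Summit.QuantumFields.BalabanUV.Beta.EriceRemainderEnclosureHistoryAutonomyComparisonAgeCompositionStaticChainAdjacentEnvelopes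
open Summit.QuantumFields.BalabanUV.Beta.EriceRemainderEnclosureHistoryAutonomyComparisonAgeCompositionStaticChainAdjacentRatioEnvelopes
open Summit.QuantumFields.BalabanUV.Beta.EriceRemainderEnclosureHistoryAutonomyComparisonAgeCompositionStaticChainAdjacentStep
open Summit.QuantumFields.BalabanUV.Beta.EriceRemainderEnclosureHistoryAutonomyComparisonAgeCompositionStaticChainCrossAmplifications

/-! ## §1 Feasibility bounds the row sums: `γ < 1` -/

/-- If every row sum of `G ≥ 0` is at least `γ` and positive levels exist, then `γ < 1` ((E78a) `eq_zero_of_subsolution` with the constant vector). [folklore] -/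
theorem rowsum_lt_one {n : ℕ} {G : ℕ → ℕ → ℝ} {a : ℕ → ℝ} {γ : ℝ} (hn : 0 < n) (hG : ∀ i l, i < n → l < n → 0 ≤ G i l)
    (ha : ∀ i, i < n → 0 < a i) (hlev : ∀ i, i < n → 1 + ∑ l ∈ range n, G i l * a l ≤ a i)
    (hrow : ∀ i, i < n → γ ≤ ∑ l ∈ range n, G i l) : γ < 1 := by
  by_contra h
  have hγ : 1 ≤ γ := not_lt.mp h
  have hz := eq_zero_of_subsolution (v := fun _ => (1:ℝ)) hG ha hlev (fun _ _ => zero_le_one)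
    (fun i hi => by simpa using le_trans hγ (hrow i hi))
  have := hz 0 hn
  norm_num at this

/-! ## §2 The observer step for an actual configuration above an adjacent pair, `z ≥ 16` -/
set_option maxHeartbeats 400000 in
/-- **THE OBSERVER STEP (◆) FOR EVERY LEVEL-COUPLED CONFIGURATION ABOVE AN ADJACENT PAIR `(y, z) = (z+1, z)`, `z ≥ 16`.**  Letters: `n ≥ 1` older ages `k_l ≥ z+2`,
loads `x_l ≥ 0`; read windows `Sy_l = S_{k_l,z+1}`, `Sz_l = S_{k_l,z}`, `Ry_l = S_{z+1,k_l}`, `Rz_l = S_{z,k_l}`; the array `G_{il} = 2x_lS_{k_l,k_i}∕k_l` with exact positive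
levels `a`; `cy`, `cz` the exact responses to `Ry∕(z+1)`, `Rz∕z`; amplifications `Ψyy = Σ(2x_lSy_l∕k_l)cy_l`, `Ψyz = Σ(2x_lSz_l∕k_l)cy_l`, `Ψzy = Σ(2x_lSy_l∕k_l)cz_l`,
`Ψzz = Σ(2x_lSz_l∕k_l)cz_l`; `Ωz = Σx_lz∕k_l`; `σ = S_{z+1,z}∕(z+1)`, `φ = S_{z,z+1}∕z`, `s = S_{z+1,z+1}∕(z+1)`; a defect `θ ≤ 0.7856` (`θ̄((z+1)∕z)` qualifies,
(E78f) `thetabar_le_envelope`); the load `xy ≥ 0` of the new age below its cap `2·xy·(s + Ψyy) < 1` ((E78b) `pivot_pos`).  CONCLUSION: the hypothesis `hdia` of (E78a)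
`observer_step` (`κ = 31∕40`, `q = (z+1)∕z`): the observer bound `N_z ≤ (1+2κΨ_zz)(1−Ω_z)` PROPAGATES when the age `z+1` is added, for EVERY configuration of older
ages and EVERY admissible load.  Every ingredient is a tree theorem: (E78h) `cross_gram_bounds`∕`response_ratio_bounds` with (E78c) `charge_ratio_ge`,
`read_ratio_ge`, (E78b) `readWindow_mono_right`, (E78f) `read_ratio_le`; (E78b) `return_amplification_ge_lattice` with (E78e) `lam1_ge`∕`lam2_ge` and §1; (E78e)
`sigma_ge`∕`sigma_le`∕`phi_ge`∕`phi_le`∕`self_ge`; (E78g) `adjacent_step`. [folklore] -/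
theorem adjacent_step_lattice {n z : ℕ} {k : ℕ → ℕ} {x a cy cz Sy Sz Ry Rz : ℕ → ℝ} {θ xy Ψyy Ψyz Ψzy Ψzz Ωz σ φ s : ℝ}
    (hn : 0 < n) (hz : 16 ≤ z) (hk : ∀ l, l < n → z + 2 ≤ k l) (hx : ∀ l, l < n → 0 ≤ x l)
    (hSy : ∀ l, l < n → Sy l = ∑ m ∈ range (z + 1), Real.sqrt ((k l : ℝ) / ((k l : ℝ) + m + 1)))
    (hSz : ∀ l, l < n → Sz l = ∑ m ∈ range z, Real.sqrt ((k l : ℝ) / ((k l : ℝ) + m + 1)))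
    (hRy : ∀ l, l < n → Ry l = ∑ m ∈ range (k l), Real.sqrt (((z:ℝ) + 1) / (((z:ℝ) + 1) + m + 1)))
    (hRz : ∀ l, l < n → Rz l = ∑ m ∈ range (k l), Real.sqrt ((z : ℝ) / ((z : ℝ) + m + 1)))
    (ha0 : ∀ i, i < n → 0 < a i)
    (ha : ∀ i, i < n → a i = 1 + ∑ l ∈ range n,
      (2 * x l * (∑ m ∈ range (k i), Real.sqrt ((k l : ℝ) / ((k l : ℝ) + m + 1))) / k l) * a l)
    (hcy : ∀ i, i < n → cy i = Ry i / ((z:ℝ) + 1) + ∑ l ∈ range n,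
      (2 * x l * (∑ m ∈ range (k i), Real.sqrt ((k l : ℝ) / ((k l : ℝ) + m + 1))) / k l) * cy l)
    (hcz : ∀ i, i < n → cz i = Rz i / (z:ℝ) + ∑ l ∈ range n,
      (2 * x l * (∑ m ∈ range (k i), Real.sqrt ((k l : ℝ) / ((k l : ℝ) + m + 1))) / k l) * cz l)
    (hΨyy : Ψyy = ∑ l ∈ range n, (2 * x l * Sy l / k l) * cy l) (hΨyz : Ψyz = ∑ l ∈ range n, (2 * x l * Sz l / k l) * cy l)
    (hΨzy : Ψzy = ∑ l ∈ range n, (2 * x l * Sy l / k l) * cz l) (hΨzz : Ψzz = ∑ l ∈ range n, (2 * x l * Sz l / k l) * cz l)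
    (hΩz : Ωz = ∑ l ∈ range n, x l * (z:ℝ) / k l)
    (hσ : σ = (∑ m ∈ range z, Real.sqrt (((z:ℝ) + 1) / (((z:ℝ) + 1) + m + 1))) / ((z:ℝ) + 1))
    (hφ : φ = (∑ m ∈ range (z + 1), Real.sqrt ((z : ℝ) / ((z : ℝ) + m + 1))) / (z:ℝ))
    (hs : s = (∑ m ∈ range (z + 1), Real.sqrt (((z:ℝ) + 1) / (((z:ℝ) + 1) + m + 1))) / ((z:ℝ) + 1))
    (hθ : θ ≤ 491/625) (hxy : 0 ≤ xy) (hcap : 2 * xy * (s + Ψyy) < 1) :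
    (1 + 2 * (31/40:ℝ) * Ψzz) * (1 - Ωz) - (1 - θ) * (xy * (1 + 2 * (31/40:ℝ) * Ψyy))
      ≤ (1 - xy * (1 + 2 * (31/40:ℝ) * Ψyy)) *
        ((1 + 2 * (31/40:ℝ) * Ψzz + 4 * (31/40:ℝ) * xy * ((σ + Ψyz) * (φ + Ψzy)) / (1 - 2 * (s + Ψyy) * xy)) * ((1 - Ωz) - xy / (((z:ℝ) + 1) / (z:ℝ)))) := by
  -- positivity of the letters
  have hz' : (16 : ℝ) ≤ z := by exact_mod_cast hz
  have hzp : (0 : ℝ) < z := by linarith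
  have hz1 : (0 : ℝ) < (z:ℝ) + 1 := by linarith
  have hkpos : ∀ l, l < n → (0 : ℝ) < k l := fun l hl => by have := hk l hl; exact_mod_cast (show 0 < k l by omega)
  have hkge : ∀ l, l < n → (z:ℝ) + 2 ≤ (k l : ℝ) := fun l hl => by exact_mod_cast hk l hl
  have hG : ∀ i l, i < n → l < n → 0 ≤ 2 * x l * (∑ m ∈ range (k i), Real.sqrt ((k l : ℝ) / ((k l : ℝ) + m + 1))) / k l :=
    fun i l hi hl => by
      have := hx l hl; have := hkpos l hl
      have : 0 ≤ ∑ m ∈ range (k i), Real.sqrt ((k l : ℝ) / ((k l : ℝ) + m + 1)) := sum_nonneg fun _ _ => Real.sqrt_nonneg _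
      positivity
  have hlev : ∀ i, i < n → 1 + ∑ l ∈ range n, (2 * x l * (∑ m ∈ range (k i), Real.sqrt ((k l : ℝ) / ((k l : ℝ) + m + 1))) / k l) * a l ≤ a i :=
    fun i hi => (ha i hi).symm.le
  have hRy0 : ∀ i, i < n → 0 ≤ Ry i / ((z:ℝ) + 1) := fun i hi => by
    rw [hRy i hi]; exact div_nonneg (sum_nonneg fun _ _ => Real.sqrt_nonneg _) hz1.le
  have hcy0 : ∀ i, i < n → 0 ≤ cy i := nonneg_of_response hG ha0 hlev hRy0 hcy
  have hSy0 : ∀ l, l < n → 0 < Sy l := fun l hl => by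
    rw [hSy l hl]; apply sum_pos (fun m _ => Real.sqrt_pos.mpr (by have := hkpos l hl; positivity)) (by simp)
  -- (A) charge ratios `α_l = Sz_l ∕ Sy_l ∈ [16∕17, 1]`
  have hα : ∀ l, l < n → (16/17:ℝ) ≤ Sz l / Sy l ∧ Sz l / Sy l ≤ 16/17 + 1/17 := by
    intro l hl
    have h1 := charge_ratio_ge (k := (k l : ℝ)) (hkpos l hl).le (Nat.le_succ z)   -- S_{k,z+1}·z ≤ S_{k,z}·(z+1)
    have h2 := readWindow_mono_right (k l : ℝ) (Nat.le_succ z)                    -- S_{k,z} ≤ S_{k,z+1}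
    rw [← hSy l hl, ← hSz l hl] at h1 h2
    push_cast at h1
    constructor
    · rw [le_div_iff₀ (hSy0 l hl)]; nlinarith [hSy0 l hl]
    · rw [div_le_iff₀ (hSy0 l hl)]; linarith
  -- (B) response ratios `cz ∈ [1, 1.0607]·cy` from `Rz∕z ∈ [1, 1.0607]·Ry∕(z+1)`
  have hβ := response_ratio_bounds (βl := 1) (Δβ := 607/10000) (φy := fun i => Ry i / ((z:ℝ) + 1)) (φz := fun i => Rz i / (z:ℝ)) hG ha0 hlev hcy hcz
    (fun i hi => by
      have h := read_ratio_ge hzp (by linarith : (z:ℝ) ≤ (z:ℝ) + 1) (k i)   -- √(z/(z+1))·Ry ≤ Rz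
      rw [← hRy i hi, ← hRz i hi] at h
      have hsq : (z:ℝ) / ((z:ℝ) + 1) ≤ Real.sqrt ((z:ℝ) / ((z:ℝ) + 1)) := by
        have hle1 : (z:ℝ) / ((z:ℝ) + 1) ≤ 1 := by rw [div_le_one hz1]; linarith
        have h0 : 0 ≤ (z:ℝ) / ((z:ℝ) + 1) := by positivity
        calc (z:ℝ) / ((z:ℝ) + 1) = Real.sqrt ((z:ℝ) / ((z:ℝ) + 1)) * Real.sqrt ((z:ℝ) / ((z:ℝ) + 1)) := (Real.mul_self_sqrt h0).symm
          _ ≤ Real.sqrt ((z:ℝ) / ((z:ℝ) + 1)) * 1 := mul_le_mul_of_nonneg_left (Real.sqrt_le_one.mpr hle1) (Real.sqrt_nonneg _)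
          _ = _ := mul_one _
      have hRy0' : 0 ≤ Ry i := by rw [hRy i hi]; exact sum_nonneg fun _ _ => Real.sqrt_nonneg _
      show 1 * (Ry i / ((z:ℝ) + 1)) ≤ Rz i / (z:ℝ)
      rw [one_mul, div_le_div_iff₀ hz1 hzp]
      have := mul_le_mul_of_nonneg_right hsq hRy0'
      have e : (z:ℝ) / ((z:ℝ) + 1) * Ry i * ((z:ℝ) + 1) = Ry i * z := by field_simp
      nlinarith [mul_le_mul_of_nonneg_right (le_trans this h) hz1.le])
    (fun i hi => by
      have h := read_ratio_le hz (k i)     -- (z+1)·Rz ≤ 1.0607·z·Ry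
      rw [← hRy i hi, ← hRz i hi] at h
      show Rz i / (z:ℝ) ≤ (1 + 607/10000) * (Ry i / ((z:ℝ) + 1))
      rw [div_le_iff₀ hzp]
      have e : (1 + 607/10000 : ℝ) * (Ry i / ((z:ℝ) + 1)) * (z:ℝ) = (10607/10000 : ℝ) * z * Ry i / ((z:ℝ) + 1) := by ring
      rw [e, le_div_iff₀ hz1]; linarith)
  -- (C) the cross Gram through single sums
  have hcross := cross_gram_bounds (n := n) (ey := fun l => 2 * x l * Sy l / k l) (cy := cy) (cz := cz) (α := fun l => Sz l / Sy l)
    (αl := 16/17) (Δα := 1/17) (βl := 1) (Δβ := 607/10000)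
    (fun l hl => by have := hx l hl; have := hkpos l hl; have := (hSy0 l hl).le; positivity) hcy0 hα (by norm_num) (by norm_num) hβ (by norm_num)
  -- identify its four sums with the letters
  have eyz : ∑ i ∈ range n, Sz i / Sy i * (2 * x i * Sy i / k i) * cy i = Ψyz := by
    rw [hΨyz]; exact sum_congr rfl fun i hi => by have := (hSy0 i (mem_range.mp hi)).ne'; field_simp
  have ezz : ∑ i ∈ range n, Sz i / Sy i * (2 * x i * Sy i / k i) * cz i = Ψzz := by
    rw [hΨzz]; exact sum_congr rfl fun i hi => by have := (hSy0 i (mem_range.mp hi)).ne'; field_simp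
  simp only [eyz, ezz, ← hΨyy, ← hΨzy] at hcross
  obtain ⟨⟨hyz1, hyz2⟩, ⟨hzy1, hzy2⟩, ⟨hzz1, hzz2⟩, ⟨hcov1, hcov2⟩⟩ := hcross
  -- (D) the structural room `Ω_z (1.3725 + 1.6568 Ψyy) ≤ Ψyy`
  have hcy' : ∀ i, i < n → cy i = (∑ m ∈ range (k i), Real.sqrt (((z:ℝ) + 1) / (((z:ℝ) + 1) + m + 1))) / ((z:ℝ) + 1) + ∑ l ∈ range n,
      (2 * x l * (∑ m ∈ range (k i), Real.sqrt ((k l : ℝ) / ((k l : ℝ) + m + 1))) / k l) * cy l := fun i hi => by rw [← hRy i hi]; exact hcy i hi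
  -- row sums ≥ λ₂ Ω_y, hence λ₂ Ω_y < 1 (raw expressions first; abbreviations afterwards)
  have hrow : ∀ i, i < n → 2 * (∑ m ∈ range (z + 1 + 1), Real.sqrt (((z:ℝ) + 1 + 1) / (((z:ℝ) + 1 + 1) + m + 1))) / ((z:ℝ) + 1)
      * (∑ l ∈ range n, x l * ((z:ℝ) + 1) / k l) ≤
      ∑ l ∈ range n, 2 * x l * (∑ m ∈ range (k i), Real.sqrt ((k l : ℝ) / ((k l : ℝ) + m + 1))) / k l := by
    intro i hi
    rw [mul_sum]
    refine sum_le_sum fun l hl => ?_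
    have hl' := mem_range.mp hl
    have hSS : (∑ m ∈ range (z + 1 + 1), Real.sqrt (((z:ℝ) + 1 + 1) / (((z:ℝ) + 1 + 1) + m + 1))) ≤ ∑ m ∈ range (k i), Real.sqrt ((k l : ℝ) / ((k l : ℝ) + m + 1)) :=
      calc (∑ m ∈ range (z + 1 + 1), Real.sqrt (((z:ℝ) + 1 + 1) / (((z:ℝ) + 1 + 1) + m + 1)))
          ≤ ∑ m ∈ range (k i), Real.sqrt (((z:ℝ) + 1 + 1) / (((z:ℝ) + 1 + 1) + m + 1)) := readWindow_mono_right _ (by have := hk i hi; omega)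
        _ ≤ _ := Summit.QuantumFields.BalabanUV.Beta.EriceRemainderEnclosureHistoryAutonomyComparisonAgeCompositionStaticChainWindowMass.readWindow_mono_left
            (by positivity) (by linarith [hkge l hl']) (k i)
    have hxl := hx l hl'; have hkl := hkpos l hl'
    rw [show 2 * (∑ m ∈ range (z + 1 + 1), Real.sqrt (((z:ℝ) + 1 + 1) / (((z:ℝ) + 1 + 1) + m + 1))) / ((z:ℝ) + 1) * (x l * ((z:ℝ) + 1) / k l)
        = 2 * x l * (∑ m ∈ range (z + 1 + 1), Real.sqrt (((z:ℝ) + 1 + 1) / (((z:ℝ) + 1 + 1) + m + 1))) / k l by field_simp]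
    exact div_le_div_of_nonneg_right (by nlinarith) hkl.le
  have hγ1 := rowsum_lt_one hn hG ha0 hlev hrow
  have hstruct := return_amplification_ge_lattice (n := n) (y := z + 1) (k := k) (x := x) (a := a) (c := cy) (by omega)
    (fun l hl => by have := hk l hl; omega) hx ha0 ha (fun i hi => by push_cast; exact hcy' i hi) (by push_cast; exact hγ1)
  push_cast at hstruct
  have eΨ : ∑ l ∈ range n, 2 * x l * (∑ m ∈ range (z + 1), Real.sqrt ((k l : ℝ) / ((k l : ℝ) + m + 1))) / k l * cy l = Ψyy := by
    rw [hΨyy]; exact sum_congr rfl fun l hl => by rw [hSy l (mem_range.mp hl)]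
  rw [eΨ] at hstruct
  have hl1 := lam1_ge (y := z + 1) (by omega)
  have hl2 := lam2_ge (y := z + 1) (by omega)
  push_cast at hl1 hl2
  -- abbreviations (folded into everything above)
  set S11 := ∑ m ∈ range (z + 1 + 1), Real.sqrt (((z:ℝ) + 1 + 1) / (((z:ℝ) + 1 + 1) + m + 1)) with hS11
  set S01 := ∑ m ∈ range (z + 1 + 1), Real.sqrt (((z:ℝ) + 1) / (((z:ℝ) + 1) + m + 1)) with hS01
  set S10 := ∑ m ∈ range (z + 1), Real.sqrt (((z:ℝ) + 1 + 1) / (((z:ℝ) + 1 + 1) + m + 1)) with hS10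
  set Ωy := ∑ l ∈ range n, x l * ((z:ℝ) + 1) / k l with hΩy
  clear_value S11 S01 S10 Ωy
  have hΩy0 : 0 ≤ Ωy := by rw [hΩy]; exact sum_nonneg fun l hl => by have := hx l (mem_range.mp hl); have := hkpos l (mem_range.mp hl); positivity
  have hden : 0 < 1 - 2 * S11 / ((z:ℝ) + 1) * Ωy := by linarith only [hγ1]
  have hΨ0 : 0 ≤ Ψyy := by
    rw [hΨyy]; exact sum_nonneg fun l hl => mul_nonneg (by have := hx l (mem_range.mp hl); have := hkpos l (mem_range.mp hl); have := (hSy0 l (mem_range.mp hl)).le; positivity) (hcy0 l (mem_range.mp hl))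
  have hroom_y : Ωy * ((549/400:ℝ) + (2071/1250) * Ψyy) ≤ Ψyy := by
    have h1 : S01 / ((z:ℝ) + 1) * (2 * S10 / ((z:ℝ) + 1)) * Ωy ≤ Ψyy * (1 - 2 * S11 / ((z:ℝ) + 1) * Ωy) := by
      rw [← div_le_iff₀ hden]; exact hstruct
    have e1 : S01 / ((z:ℝ) + 1) * (2 * S10 / ((z:ℝ) + 1)) = (2 * S01 * S10) / (((z:ℝ) + 1) * ((z:ℝ) + 1)) := by
      rw [div_mul_div_comm]; ring
    have hL1 : (549/400:ℝ) ≤ S01 / ((z:ℝ) + 1) * (2 * S10 / ((z:ℝ) + 1)) := by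
      rw [e1, le_div_iff₀ (by positivity)]; nlinarith only [hl1]
    have hL2 : (2071/1250:ℝ) ≤ 2 * S11 / ((z:ℝ) + 1) := by rw [le_div_iff₀ hz1]; linarith only [hl2]
    nlinarith only [h1, mul_le_mul_of_nonneg_right hL1 hΩy0, mul_le_mul_of_nonneg_right hL2 (mul_nonneg hΩy0 hΨ0), hΩy0, hΨ0]
  have hΩzy : Ωz ≤ Ωy := by
    rw [hΩz, hΩy]; exact sum_le_sum fun l hl => by
      have hxl := hx l (mem_range.mp hl); have hkl := hkpos l (mem_range.mp hl)
      exact div_le_div_of_nonneg_right (by nlinarith only [hxl]) hkl.le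
  have hroom : Ωz * ((549/400:ℝ) + (2071/1250) * Ψyy) ≤ Ψyy :=
    le_trans (mul_le_mul_of_nonneg_right hΩzy (by positivity)) hroom_y
  -- (E) envelopes
  have hσ1 : (963/1250:ℝ) ≤ σ := by rw [hσ, le_div_iff₀ hz1]; exact sigma_ge hz
  have hσ2 : σ ≤ 1657/2000 := by rw [hσ, div_le_iff₀ hz1]; exact sigma_le z
  have hφ1 : (2071/2500:ℝ) ≤ φ := by rw [hφ, le_div_iff₀ hzp]; exact phi_ge (z := z) (by omega)
  have hφ2 : φ ≤ 8723/10000 := by rw [hφ, div_le_iff₀ hzp]; exact phi_le hz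
  have hs1 : (8117/10000:ℝ) ≤ s := by
    rw [hs, le_div_iff₀ hz1]; have := self_ge (n := z + 1) (by omega); push_cast at this; linarith only [this]
  -- (F) the scalar step
  have hq1 : (1:ℝ) ≤ ((z:ℝ) + 1) / (z:ℝ) := by rw [le_div_iff₀ hzp]; linarith only [hz']
  have hq2 : ((z:ℝ) + 1) / (z:ℝ) ≤ 17/16 := by rw [div_le_iff₀ hzp]; linarith only [hz']
  have hcov1' : Ψyy * Ψzz - (9/2500:ℝ) * Ψyy ^ 2 ≤ Ψyz * Ψzy := by nlinarith only [hcov1, sq_nonneg Ψyy]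
  have hcov2' : Ψyz * Ψzy ≤ Ψyy * Ψzz + (9/2500:ℝ) * Ψyy ^ 2 := by nlinarith only [hcov2, sq_nonneg Ψyy]
  exact adjacent_step hΨ0 (by linarith only [hyz1]) (by linarith only [hyz2]) (by linarith only [hzy1]) (by linarith only [hzy2]) (by linarith only [hzz1]) (by nlinarith only [hzz2, hΨ0]) hcov1' hcov2' hroom hθ hσ1 hσ2 hφ1 hφ2 hs1 hq1 hq2 hxy hcap

end Summit.QuantumFields.BalabanUV.Beta.EriceRemainderEnclosureHistoryAutonomyComparisonAgeCompositionStaticChainAdjacentStepLattice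

end
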